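import Summits.QuantumFields.BalabanUV.Beta.FP.PerfectFineWard
import Summits.QuantumFields.BalabanUV.Beta.FP.PerfectSandwichWard

/-!
# `BalabanUV.Beta.FP.PerfectFineWardSeam` — road «FP» for binder row D1: the REP∞ base-point currency at the perfect family with BOTH Ward
# inputs (`hrow` AND `hT1`) REPLACED BY THE THREE PERFECT-FAMILY LETTERS — leaf-02's divergence-freeness END
# `PerfectSandwichWard.secondMoment_TPerfOf_perfect_eq_basePoint_of_divFree` (no `hT1`, no rooting) ∘ this lineage's
# `PerfectFineWard.divFree_fineHessA_perfect_of_letters` (div-free ⟸ letters)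

HONEST DEPENDENCY (page 1, mandatory): continuum YM on T⁴ ⇐ BetaPertH ∧ nine spine estimates (0/9 proved); BetaPertH ⇐ (D1) ∧ (D4) ∧
CAP+tail; G-an2-4 gates asym, D1 and NE2/3/4.  HONEST FRAMING (cell contract, verbatim): «discharging `BetaPertH` makes Bałaban's UV
stability UNCONDITIONAL — a real constructive-QFT result; it is NOT the continuum limit and NOT the Clay problem.»  ONE composition, no new
mathematics, [folklore]; no definition, no `def … : Prop`, nothing cited; the three letters — (K) `RelInv (Π K_perf Π) 𝕄 E`, (S) the block-stencil
Ward law of `S`, (W) the second-order law (W2♮) of `Wf` against the base-point-supported generator — are HYPOTHESES (OPEN: K-side N0b∕X1 words,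
S∕W-side the wall's jet-level Ward identities inherited to the perfect limit, N3(ii)–(iv)); 0∕4 binders of row D1; NOT `hrep` (LEGS∕TAILS∕GERM
open), NOT D1, NOT BetaPertH, NOT continuum, NOT Clay.  ABSOLUTE RULE (cell charter, verbatim): «No internally-minted statement may enter as
a cited fact. Every hypothesis is either kernel-proved in this package or a verbatim quotation of a PUBLISHED theorem with page reference. The
manuscript(s) under audit are NOT citable for their own disputed steps — they are the thing under adjudication; programme-internal
(2001/route/tribunal) claims are never citable.»

CONTENT.
* `divFree_fineHessA_perfect_of_letters_single` — the letters' div-free conclusion in leaf-02's `Pi.single c 1` spelling (junction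
  `FineHessianWard.unitVec_eq_single`).
* **`secondMoment_TPerfOf_perfect_eq_basePoint_of_letters`** — `B12Beta.secondMoment (TPerfOf (Lc^m) (KPerf … m) S (vertex2OfK (KPerf … m) (Lc^m) Wf)) μ ν
  = Σ_{b ∈ resSite '' …} (Lc^m)⁻⁴ · fullSum (w ↦ (Lc^m)⁻⁸ · w_μ w_ν · baseKer (fineHessA …) b w)` from class∕covariance∕symmetry data of `S`, `Wf` and
  the THREE LETTERS only (`2 ≤ Lc`, `1 ≤ m`).
Unit `b2b-balaban-beta-d1-formalise-leaf-01` (gen 5), 2026-08-20; claim table `HOME/b2b-balaban-beta-d1-p3/LEAVES-FP.md` sub-row N3-fine-REL.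
-/

noncomputable section

open Finset Filter Topology
open scoped BigOperators

namespace Summit.QuantumFields.BalabanUV.Beta.FP.PerfectFineWardSeam

open Literature.MathematicalPhysics.QuantumFieldTheory.Balaban1983to89
open Literature.MathematicalPhysics.QuantumFieldTheory.Balaban1983to89.Beta
open ExpKernelCalculus (Site MKer Decays BiLoc comp tadpole shiftK)
open AffineAveraging (box toSite)
open AveragingContours (blk)
open KernelWard (divV divW)
open DressedMomentNormalisation (resSite)
open WindowIdentification (fullSum)
open DyadicShell (Pt toReal)
open OneStepResolventKernel (Fib LocStencil)
open AxialProjector (coProj)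
open AxialDressing (axDressK)
open SecondOrderResponse (vertex2OfK)
open Summit.QuantumFields.BalabanUV.Beta.TameKernelCalculus
open Summit.QuantumFields.BalabanUV.Beta.ChartConjugation (conjV conjW)
open Summit.QuantumFields.BalabanUV.Beta.ChartConjugationRelative (RelInv)
open Summit.QuantumFields.BalabanUV.Beta.GAN24.CombesThomas (sfStep smStep)
open Summit.QuantumFields.BalabanUV.Beta.D1BFx.MomentTransferPeriodic (baseKer)
open Summit.QuantumFields.BalabanUV.Beta.D1BFx.ReducedKernelSandwichLeg (fineHessA)
open Summit.QuantumFields.BalabanUV.Beta.D1BFx.FineHessianWard (unitVec_eq_single)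
open Summit.QuantumFields.BalabanUV.Beta.FP.PerfectObjectsT (KPerf TPerfOf)
open Summit.QuantumFields.BalabanUV.Beta.FP.PerfectFineWard (divFree_fineHessA_perfect_of_letters)
open Summit.QuantumFields.BalabanUV.Beta.FP.PerfectSandwichWard (secondMoment_TPerfOf_perfect_eq_basePoint_of_divFree)

variable {Lc : ℕ} [NeZero Lc] {m : ℕ} {M E : MKer (3 + 1) (Fib 3)}
  {S : Fin (3 + 1) → (Fin (3 + 1) → ℤ) → MKer (3 + 1) (Fib 3)} {Cs δs : ℝ}
  {Wf : Fin (3 + 1) → (Fin (3 + 1) → ℤ) → Fin (3 + 1) → (Fin (3 + 1) → ℤ) → MKer (3 + 1) (Fib 3)} {C2 δ2 : ℝ}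
  {Xc : (Fin (3 + 1) → ℤ) → MKer (3 + 1) (Fib 3)} {cH : ℝ}
  {X₂ Nr : (Fin (3 + 1) → ℤ) → Fin (3 + 1) → (Fin (3 + 1) → ℤ) → MKer (3 + 1) (Fib 3)}

/-- [folklore] The letters' first-bond divergence-freeness of the perfect dressed fine kernel, in the `Pi.single c 1` spelling of leaf-02's
`PerfectSandwichWard` ∕ `RepSeamWard` `hdiv` binder (`B6BondElimination.unitVec c = Pi.single c 1`, `FineHessianWard.unitVec_eq_single`). -/
theorem divFree_fineHessA_perfect_of_letters_single (hLc : 2 ≤ Lc) (hm : 1 ≤ m) (hM : Spr M) (hE : Spr E)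
    (hR : RelInv (axDressK (Lc ^ m) (KPerf (d := 3) Lc (sfStep Lc) (smStep 3 Lc) m)) M E)
    (hS : LocStencil S Cs δs) (hδs : 0 < δs) (hW : ∀ κ' u l' u', BiLoc (Wf κ' u l' u') u u' C2 δ2) (hδ2 : 0 < δ2)
    (hcH : cH ≠ 0) (hXc : ∀ y, Loc (Xc y)) (hEXc : ∀ y, comp E (Xc y) = comp (Xc y) E)
    (hSd : ∀ y : Fin (3 + 1) → ℤ, cH • ∑ v ∈ box (3 + 1) (Lc ^ m), divV S (((Lc ^ m : ℕ) : ℤ) • y + toSite v) = conjV M (Xc y))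
    (hX₂ : ∀ u ν u', Loc (X₂ u ν u')) (hEX₂ : ∀ u ν u', comp E (X₂ u ν u') = comp (X₂ u ν u') E)
    (hNr : ∀ u ν u', Loc (Nr u ν u'))
    (hN0 : ∀ u ν u', tadpole (axDressK (Lc ^ m) (KPerf (d := 3) Lc (sfStep Lc) (smStep 3 Lc) m)) (Nr u ν u') = 0)
    (hWd : ∀ u ν u', divW Wf u ν u' = conjW M 0 (coProj (Lc ^ m) S ν u')
      (if ((Lc ^ m : ℕ) : ℤ) • blk (Lc ^ m) u = u then cH⁻¹ • Xc (blk (Lc ^ m) u) else 0) 0 (X₂ u ν u') + Nr u ν u') :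
    ∀ (e : Fin 4) (u' u : Site 4), ∑ c : Fin 4,
      (fineHessA (axDressK (Lc ^ m) (KPerf (d := 3) Lc (sfStep Lc) (smStep 3 Lc) m)) (coProj (Lc ^ m) S) Wf c e (u - Pi.single c 1) u'
        - fineHessA (axDressK (Lc ^ m) (KPerf (d := 3) Lc (sfStep Lc) (smStep 3 Lc) m)) (coProj (Lc ^ m) S) Wf c e u u') = 0 := by
  intro e u' u
  have h := divFree_fineHessA_perfect_of_letters hLc hm hM hE hR hS hδs hW hδ2 hcH hXc hEXc hSd hX₂ hEX₂ hNr hN0 hWd e u' u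
  simpa only [unitVec_eq_single] using h

/-- [folklore] **THE REP∞ BASE-POINT CURRENCY AT THE PERFECT FAMILY FROM THE THREE LETTERS — NO `hrow`, NO `hT1`, NO ROOTING ∕ REFLECTION
HYPOTHESIS** (`2 ≤ Lc`, `1 ≤ m`): leaf-02's `PerfectSandwichWard.secondMoment_TPerfOf_perfect_eq_basePoint_of_divFree` with its one Ward datum `hdiv`
DISCHARGED by `divFree_fineHessA_perfect_of_letters`.  Every other hypothesis verbatim (class data, coarse covariance, symmetry of `S`, `Wf`). -/
theorem secondMoment_TPerfOf_perfect_eq_basePoint_of_letters (hLc : 2 ≤ Lc) (hm : 1 ≤ m) (hM : Spr M) (hE : Spr E)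
    (hR : RelInv (axDressK (Lc ^ m) (KPerf (d := 3) Lc (sfStep Lc) (smStep 3 Lc) m)) M E)
    (hS : LocStencil S Cs δs) (hδs : 0 < δs)
    (hScov : ∀ κ u t, S κ (u + ((Lc ^ m : ℕ) : ℤ) • t) = shiftK (-(((Lc ^ m : ℕ) : ℤ) • t)) (S κ u))
    (hW : ∀ κ' u l' u', BiLoc (Wf κ' u l' u') u u' C2 δ2) (hδ2 : 0 < δ2)
    (hWcov : ∀ κ' u l' u' t, Wf κ' (u + ((Lc ^ m : ℕ) : ℤ) • t) l' (u' + ((Lc ^ m : ℕ) : ℤ) • t)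
      = shiftK (-(((Lc ^ m : ℕ) : ℤ) • t)) (Wf κ' u l' u'))
    (hWsymm : ∀ (κ' : Fin 4) (u : Site 4) (l' : Fin 4) (u' : Site 4), Wf κ' u l' u' = Wf l' u' κ' u)
    (hcH : cH ≠ 0) (hXc : ∀ y, Loc (Xc y)) (hEXc : ∀ y, comp E (Xc y) = comp (Xc y) E)
    (hSd : ∀ y : Fin (3 + 1) → ℤ, cH • ∑ v ∈ box (3 + 1) (Lc ^ m), divV S (((Lc ^ m : ℕ) : ℤ) • y + toSite v) = conjV M (Xc y))
    (hX₂ : ∀ u ν u', Loc (X₂ u ν u')) (hEX₂ : ∀ u ν u', comp E (X₂ u ν u') = comp (X₂ u ν u') E)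
    (hNr : ∀ u ν u', Loc (Nr u ν u'))
    (hN0 : ∀ u ν u', tadpole (axDressK (Lc ^ m) (KPerf (d := 3) Lc (sfStep Lc) (smStep 3 Lc) m)) (Nr u ν u') = 0)
    (hWd : ∀ u ν u', divW Wf u ν u' = conjW M 0 (coProj (Lc ^ m) S ν u')
      (if ((Lc ^ m : ℕ) : ℤ) • blk (Lc ^ m) u = u then cH⁻¹ • Xc (blk (Lc ^ m) u) else 0) 0 (X₂ u ν u') + Nr u ν u')
    (μ ν : Fin 4) :
    B12Beta.secondMoment (TPerfOf (Lc ^ m) (KPerf (d := 3) Lc (sfStep Lc) (smStep 3 Lc) m) S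
        (vertex2OfK (KPerf (d := 3) Lc (sfStep Lc) (smStep 3 Lc) m) (Lc ^ m) Wf)) μ ν
      = ∑ b ∈ (univ : Finset (Fin 4 → Fin (Lc ^ m))).image resSite, ((((Lc ^ m : ℕ) : ℝ)) ^ 4)⁻¹ *
          fullSum (fun w : Pt => ((((Lc ^ m : ℕ) : ℝ)) ^ 8)⁻¹ * (toReal w μ * toReal w ν *
            baseKer (fineHessA (axDressK (Lc ^ m) (KPerf (d := 3) Lc (sfStep Lc) (smStep 3 Lc) m)) (coProj (Lc ^ m) S) Wf μ ν) b w)) :=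
  secondMoment_TPerfOf_perfect_eq_basePoint_of_divFree hLc hm hS hδs hScov hW hδ2 hWcov hWsymm
    (divFree_fineHessA_perfect_of_letters_single hLc hm hM hE hR hS hδs hW hδ2 hcH hXc hEXc hSd hX₂ hEX₂ hNr hN0 hWd) μ ν

end Summit.QuantumFields.BalabanUV.Beta.FP.PerfectFineWardSeam

end
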